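import Summits.QuantumFields.YangMills.Theorems.FluctuationComparisonRegPrIntLS2BetaIsolOfCriticalOrbitUnique
import Summits.QuantumFields.YangMills.Theorems.UnitScaleTiltProp8EulerLagrangeCarrier
import Summits.QuantumFields.YangMills.Theorems.FluctuationComparisonRegPrIntLS2BetaSignedCombLipschitz
import HarnessLib

/-!
# (RG-K) The regime letter `hreg` of ISOL∘(δ) is FREE for small tubes — definition-free glue

Helper for crux `stmt-QuantumFields-20520` (`Theses.UnitScaleTilt.FluctuationComparisonRegPrIntL`), the (T)-chain of LINE
`semiclassical_s2beta` (cell `ym3-torus`, width seat «width 16» px16 g18).  ✓`…S2BetaIsolOfCriticalOrbitUnique.isol_of_atMostOneCriticalOrbit`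
(px8 g18, p798217) derives the chain's ISOL∘(δ) letter from [Balaban1985Variational] Prop. 7 clause 1 at the datum plus ONE regime letter

  `hreg` : «a point of the closed good fibre inside the sup-`δ`-tube of the residual orbit of the base point `U₀`, with `A ≤ min`, is
  `ε₀`-regular (`∈ regFibrePr F J K hJK ε₀ V`)».

THIS FILE discharges `hreg` for every `δ` below a threshold `δ₀ > 0` depending on the base point (print, [Balaban1985Variational] p.301:
«a sufficiently small neighborhood of U′_k … is contained in (6)»; p.278: «the space 𝔘_k is gauge invariant»):

* §1 ★ `exists_delta_regPr_of_tube` — if `U₀ ∈ 𝔘_k(ε₀)` (`RegPr`, `0 ≤ ε₀`) there is `δ₀ > 0` such that EVERY configuration bondwise within `δ₀`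
  of ANY gauge translate `w • U₀` (descent-preserving or not) lies in `𝔘_k(ε₀)`: undo `w` (the bondwise distance `dist1 (U ℓ·((w•U₀) ℓ)⁻¹)`
  is a conjugate of `dist1 ((w⁻¹•U) ℓ·(U₀ ℓ)⁻¹) = ‖(w⁻¹•U) ℓ − U₀ ℓ‖`), apply ✓`Prop8Criticality.exists_ball_subset_regPr` (𝔘_k(ε₀) is open in
  the bonds) and ✓`regPr_gaugeAct_iff` (𝔘_k(ε₀) is gauge invariant).
* §2 ★ `exists_delta_hreg` — with the closed-fibre letter CL(V) (`closure (fibre V ∩ histGood) ⊆ fibre V`, ✓`exists_gamma_closedGoodFibre`)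
  the `hreg` binder of ✓`isol_of_atMostOneCriticalOrbit` holds VERBATIM for every `δ ≤ δ₀` (the clause `A ≤ min` is not even used).
* §3 ★★ `exists_delta_isol_of_atMostOneCriticalOrbit` — hence ISOL∘(δ) (the `hisol` binder of (T3) ∕ ✓px8 `tubeGrowth_of_pos_of_isolated`,
  VERBATIM) ⟸ {Prop. 7 clause 1 at `(ε₀, V)`, `U₀` an `ε₀`-regular minimiser, CL(V)} for every `δ ≤ δ₀(U₀)`, with NO regime letter.  GAP♭ consumes
  ISOL∘ at ONE positive `δ` (✓`…S2BetaFlatGapOfIsolated` §1, ✓(T3) dock), so at every datum where Prop. 7 clause 1 is a theorem (central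
  stabiliser: ✓`…S2BetaCriticalOrbitUnique`, `L ≥ 5`; flat: ✓`Prop7FlatDatum`) GAP♭'s ISOL∘ letter is gone.

HONEST: topology ∕ group bookkeeping over landed letters; `δ₀` DEPENDS ON THE BASE POINT (openness), it is NOT the organ's datum-free `δ`;
Prop. 7 clause 1 and CL(V) are hypotheses of §3; this file proves NO stub of the line — TUBE-REG∘ (K-uniform `μ`, universal `δ`), GAP♯∘, EXW∘,
S2β and crux 20520 stay OPEN; rung R3 (YM₃ on T³) is NOT d = 4, NOT infinite volume, NOT a mass gap, NOT Clay; the Yang–Mills mass gap is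
NOT proved.
-/

set_option autoImplicit false

noncomputable section

open Set
open scoped Matrix.Norms.L2Operator
open Literature.MathematicalPhysics.QuantumFieldTheory.Balaban1983to89
open Literature.MathematicalPhysics.QuantumFieldTheory.Balaban1983to89.T3ContinuumYM3Torus
open Literature.MathematicalPhysics.QuantumFieldTheory.Balaban1983to89.T3UnitLawDensityEML
open Literature.MathematicalPhysics.QuantumFieldTheory.Balaban1983to89.T3UnitScaleTilt
open Literature.MathematicalPhysics.QuantumFieldTheory.Balaban1983to89.T3TiltDescent
open Literature.MathematicalPhysics.QuantumFieldTheory.Balaban1983to89.T3ConstrainedMinimiser (fibre)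
open Literature.MathematicalPhysics.QuantumFieldTheory.Balaban1983to89.T3PrintedRegularMinimiser
open Literature.MathematicalPhysics.QuantumFieldTheory.Balaban1983to89.T3PrintedRegularOrbits
open Literature.MathematicalPhysics.QuantumFieldTheory.Balaban1983to89.T3Thm1Carrier
open scoped Literature.MathematicalPhysics.QuantumFieldTheory.Balaban1983to89.T3OrbitAverage
open Summit.QuantumFields.YangMills.Theorems.FluctuationComparisonRegPrIntLS2BetaIsolOfCriticalOrbitUnique (isol_of_atMostOneCriticalOrbit)
open Summit.QuantumFields.YangMills.Theorems.Prop8Criticality (exists_ball_subset_regPr)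
open Summit.QuantumFields.YangMills.Theorems.FluctuationComparisonRegPrIntLS2BetaSignedCombLipschitz (dist1_mul_inv_eq_norm_sub)

namespace Summit.QuantumFields.YangMills.Theorems.FluctuationComparisonRegPrIntLS2BetaTubeRegularSmall

variable (F : T3Family) {J K : ℕ} (hJK : J ≤ K)

/-! ## §1 Print's regular space absorbs a small sup-tube about any gauge translate of a regular point -/

/-- Undoing the gauge translate: the bondwise distance from `U` to `w • U₀` equals the bondwise distance from `w⁻¹ • U` to `U₀`
(conjugation invariance of `dist1`). [cite: Balaban1985Averaging, (8) p.19] -/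
theorem dist1_inv_gaugeAct_eq (w : Site (F.P K) 0 → Matrix.specialUnitaryGroup (Fin 2) ℂ)
    (U U₀ : GaugeField (F.P K) 0 (Matrix.specialUnitaryGroup (Fin 2) ℂ)) (ℓ : PBond (F.P K) 0) :
    dist1 ((GaugeField.gaugeAct (fun x => (w x)⁻¹) U) ℓ * (U₀ ℓ)⁻¹) = dist1 (U ℓ * ((GaugeField.gaugeAct w U₀) ℓ)⁻¹) := by
  have h1 : (GaugeField.gaugeAct (fun x => (w x)⁻¹) U) ℓ * (U₀ ℓ)⁻¹ =
      (w ℓ.src)⁻¹ * (U ℓ * ((GaugeField.gaugeAct w U₀) ℓ)⁻¹) * ((w ℓ.src)⁻¹)⁻¹ := by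
    show (w ℓ.src)⁻¹ * U ℓ * ((w ℓ.tgt)⁻¹)⁻¹ * (U₀ ℓ)⁻¹ = (w ℓ.src)⁻¹ * (U ℓ * (w ℓ.src * U₀ ℓ * (w ℓ.tgt)⁻¹)⁻¹) * ((w ℓ.src)⁻¹)⁻¹
    group
  rw [h1, GaugeGroup.dist1_conj]

/-- `w • (w⁻¹ • U) = U`. [cite: Balaban1985Averaging, (8) p.19] -/
theorem gaugeAct_gaugeAct_inv (w : Site (F.P K) 0 → Matrix.specialUnitaryGroup (Fin 2) ℂ)
    (U : GaugeField (F.P K) 0 (Matrix.specialUnitaryGroup (Fin 2) ℂ)) :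
    GaugeField.gaugeAct w (GaugeField.gaugeAct (fun x => (w x)⁻¹) U) = U := by
  funext b
  show w b.src * ((w b.src)⁻¹ * U b * ((w b.tgt)⁻¹)⁻¹) * (w b.tgt)⁻¹ = U b
  group

/-- ★ **𝔘_k(ε₀) ABSORBS A SMALL SUP-TUBE ABOUT EVERY GAUGE TRANSLATE OF A REGULAR POINT.**  If `U₀ ∈ 𝔘_k(ε₀)` (`RegPr`, `0 ≤ ε₀`) there is
`δ₀ > 0` (depending on `U₀`) such that every `U` bondwise within `δ₀` of some `w • U₀` — `w` ANY gauge transformation of the fine lattice —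
lies in `𝔘_k(ε₀)`: `w⁻¹ • U` is bondwise within `δ₀` of `U₀` (`dist1_inv_gaugeAct_eq`, ✓`dist1_mul_inv_eq_norm_sub`), hence regular
(✓`exists_ball_subset_regPr`: 𝔘_k is open in the bonds), hence so is `U = w • (w⁻¹ • U)` (✓`regPr_gaugeAct_iff`: 𝔘_k is gauge invariant).
[cite: Balaban1985Variational, (2) p.278 and p.278 (sentence after (3)), p.301] -/
theorem exists_delta_regPr_of_tube {ε₀ : ℝ} (hε₀ : 0 ≤ ε₀) {U₀ : GaugeField (F.P K) 0 (Matrix.specialUnitaryGroup (Fin 2) ℂ)}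
    (hU₀ : RegPr F J K ε₀ U₀) :
    ∃ δ₀ : ℝ, 0 < δ₀ ∧ ∀ (w : Site (F.P K) 0 → Matrix.specialUnitaryGroup (Fin 2) ℂ)
      (U : GaugeField (F.P K) 0 (Matrix.specialUnitaryGroup (Fin 2) ℂ)),
      (∀ ℓ : PBond (F.P K) 0, dist1 (U ℓ * ((GaugeField.gaugeAct w U₀) ℓ)⁻¹) ≤ δ₀) → RegPr F J K ε₀ U := by
  obtain ⟨δ, hδ, hball⟩ := exists_ball_subset_regPr F J K ε₀ U₀ hU₀
  refine ⟨δ / 2, half_pos hδ, fun w U htube => ?_⟩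
  have hW : RegPr F J K ε₀ (GaugeField.gaugeAct (fun x => (w x)⁻¹) U) := by
    refine hball _ fun b => ?_
    rw [← dist1_mul_inv_eq_norm_sub, dist1_inv_gaugeAct_eq]
    exact (htube b).trans_lt (half_lt_self hδ)
  have := (regPr_gaugeAct_iff F hε₀ w (GaugeField.gaugeAct (fun x => (w x)⁻¹) U)).2 hW
  rwa [gaugeAct_gaugeAct_inv] at this

/-- The same read in print's regular FIBRE: with the closed-fibre letter CL(V) every point of the closed good fibre in the sup-`δ₀`-tube of any
gauge translate of `U₀ ∈ regFibrePr F J K hJK ε₀ V` lies in `regFibrePr F J K hJK ε₀ V`. [cite: Balaban1985Variational, (2)-(3) and (6) p.278] -/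
theorem exists_delta_regFibrePr_of_tube {γ b₀ p₀ ε₀ : ℝ} (hε₀ : 0 ≤ ε₀)
    {V : GaugeField (F.P J) 0 (Matrix.specialUnitaryGroup (Fin 2) ℂ)} {U₀ : GaugeField (F.P K) 0 (Matrix.specialUnitaryGroup (Fin 2) ℂ)}
    (hU₀ : U₀ ∈ regFibrePr F J K hJK ε₀ V)
    (hCL : closure (fibre F ℰp J K hJK V ∩ histGood F ℰp (θBal F.L γ b₀ p₀) K J) ⊆ fibre F ℰp J K hJK V) :
    ∃ δ₀ : ℝ, 0 < δ₀ ∧ ∀ (w : Site (F.P K) 0 → Matrix.specialUnitaryGroup (Fin 2) ℂ),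
      ∀ U ∈ closure (fibre F ℰp J K hJK V ∩ histGood F ℰp (θBal F.L γ b₀ p₀) K J),
      (∀ ℓ : PBond (F.P K) 0, dist1 (U ℓ * ((GaugeField.gaugeAct w U₀) ℓ)⁻¹) ≤ δ₀) → U ∈ regFibrePr F J K hJK ε₀ V := by
  obtain ⟨δ₀, hδ₀, hreg⟩ := exists_delta_regPr_of_tube F hε₀ ((mem_regFibrePr_iff F).1 hU₀).2
  exact ⟨δ₀, hδ₀, fun w U hU htube => (mem_regFibrePr_iff F).2 ⟨hCL hU, hreg w U htube⟩⟩

/-! ## §2 The `hreg` binder of ✓`isol_of_atMostOneCriticalOrbit`, discharged for small `δ` -/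

/-- ★ **`hreg` FOR EVERY `δ ≤ δ₀(U₀)`** — the regime binder of ✓`…S2BetaIsolOfCriticalOrbitUnique.isol_of_atMostOneCriticalOrbit` VERBATIM, from
CL(V) alone (its clause `A ≤ min` is not used). [cite: Balaban1985Variational, (6) p.278, p.301] -/
theorem exists_delta_hreg {γ b₀ p₀ ε₀ : ℝ} (hε₀ : 0 ≤ ε₀)
    {V : GaugeField (F.P J) 0 (Matrix.specialUnitaryGroup (Fin 2) ℂ)} {U₀ : GaugeField (F.P K) 0 (Matrix.specialUnitaryGroup (Fin 2) ℂ)}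
    (hU₀ : U₀ ∈ regFibrePr F J K hJK ε₀ V)
    (hCL : closure (fibre F ℰp J K hJK V ∩ histGood F ℰp (θBal F.L γ b₀ p₀) K J) ⊆ fibre F ℰp J K hJK V) :
    ∃ δ₀ : ℝ, 0 < δ₀ ∧ ∀ δ : ℝ, δ ≤ δ₀ →
      ∀ U ∈ closure (fibre F ℰp J K hJK V ∩ histGood F ℰp (θBal F.L γ b₀ p₀) K J),
        (∃ w : Site (F.P K) 0 → Matrix.specialUnitaryGroup (Fin 2) ℂ,
          (∀ U'' : GaugeField (F.P K) 0 (Matrix.specialUnitaryGroup (Fin 2) ℂ),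
              descendTo F ℰp J K hJK (GaugeField.gaugeAct w U'') = descendTo F ℰp J K hJK U'') ∧
            ∀ ℓ : PBond (F.P K) 0, dist1 (U ℓ * ((GaugeField.gaugeAct w U₀) ℓ)⁻¹) ≤ δ) →
        wilsonAction4 U ≤ minActionRegPr F J K hJK ε₀ V → U ∈ regFibrePr F J K hJK ε₀ V := by
  obtain ⟨δ₀, hδ₀, hreg⟩ := exists_delta_regFibrePr_of_tube F hJK hε₀ hU₀ hCL
  refine ⟨δ₀, hδ₀, fun δ hδ U hU htube _ => ?_⟩
  obtain ⟨w, -, hw⟩ := htube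
  exact hreg w U hU fun ℓ => (hw ℓ).trans hδ

/-! ## §3 ISOL∘(δ) for small `δ` from Prop. 7 clause 1 alone -/

/-- ★★ **ISOL∘(δ) ⟸ {PROP. 7 CLAUSE 1 AT `(ε₀, V)`, `U₀` AN `ε₀`-REGULAR MINIMISER, CL(V)} FOR EVERY `δ ≤ δ₀(U₀)` — NO REGIME LETTER.**  The conclusion
is the `hisol` binder of ✓`…S2BetaTubeGrowthOfIsolated.tubeGrowth_of_pos_of_isolated` ∕ (T3) `…TubeGrowthOfHessianPosDock` VERBATIM; proof =
✓px8 `isol_of_atMostOneCriticalOrbit` with `hreg` supplied by §2.  Consumers: at every datum with central stabiliser `h1` is ✓`atMostOneCriticalOrbit_of_centralStab_five`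
(`L ≥ 5`, `ε₀ ≤ e₈(L)`); at the flat datum it is ✓`Prop7FlatDatum.atMostOneCriticalOrbit_one`; CL(V) is ✓`exists_gamma_closedGoodFibre` for `γ ≤ γ₁(L, b₀, p₀)`.
[cite: Balaban1985Variational, Prop. 7 p.299, (4)-(6) p.278, p.301] -/
theorem exists_delta_isol_of_atMostOneCriticalOrbit {γ b₀ p₀ ε₀ : ℝ} (hε₀ : 0 < ε₀)
    (V : GaugeField (F.P J) 0 (Matrix.specialUnitaryGroup (Fin 2) ℂ)) (U₀ : GaugeField (F.P K) 0 (Matrix.specialUnitaryGroup (Fin 2) ℂ))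
    (h1 : (varProblem3 F J K hJK).AtMostOneCriticalOrbit ε₀ V)
    (hU₀ : U₀ ∈ regFibrePr F J K hJK ε₀ V) (hmin : wilsonAction4 U₀ = minActionRegPr F J K hJK ε₀ V)
    (hCL : closure (fibre F ℰp J K hJK V ∩ histGood F ℰp (θBal F.L γ b₀ p₀) K J) ⊆ fibre F ℰp J K hJK V) :
    ∃ δ₀ : ℝ, 0 < δ₀ ∧ ∀ δ : ℝ, δ ≤ δ₀ →
      ∀ U ∈ closure (fibre F ℰp J K hJK V ∩ histGood F ℰp (θBal F.L γ b₀ p₀) K J),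
        (∃ w : Site (F.P K) 0 → Matrix.specialUnitaryGroup (Fin 2) ℂ,
          (∀ U'' : GaugeField (F.P K) 0 (Matrix.specialUnitaryGroup (Fin 2) ℂ),
              descendTo F ℰp J K hJK (GaugeField.gaugeAct w U'') = descendTo F ℰp J K hJK U'') ∧
            ∀ ℓ : PBond (F.P K) 0, dist1 (U ℓ * ((GaugeField.gaugeAct w U₀) ℓ)⁻¹) ≤ δ) →
        wilsonAction4 U ≤ minActionRegPr F J K hJK ε₀ V →
        (⨅ w : {w : Site (F.P K) 0 → Matrix.specialUnitaryGroup (Fin 2) ℂ |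
            ∀ U : GaugeField (F.P K) 0 (Matrix.specialUnitaryGroup (Fin 2) ℂ),
              descendTo F ℰp J K hJK (GaugeField.gaugeAct w U) = descendTo F ℰp J K hJK U},
          ∑ ℓ : PBond (F.P K) 0,
            dist1 (U ℓ * ((GaugeField.gaugeAct (w : Site (F.P K) 0 → Matrix.specialUnitaryGroup (Fin 2) ℂ) U₀) ℓ)⁻¹) ^ 2) = 0 := by
  obtain ⟨δ₀, hδ₀, hreg⟩ := exists_delta_hreg F hJK hε₀.le hU₀ hCL
  exact ⟨δ₀, hδ₀, fun δ hδ => isol_of_atMostOneCriticalOrbit F hJK hε₀ V U₀ δ h1 hU₀ hmin (hreg δ hδ)⟩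

end Summit.QuantumFields.YangMills.Theorems.FluctuationComparisonRegPrIntLS2BetaTubeRegularSmall

end
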